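import Summits.QuantumFields.BalabanUV.T4Continuum.Support.NE7MinimalOrbitDatumContinuity
import HarnessLib

/-!
# NE7MinimalOrbitDatumContinuityGauge — THE ORBIT MAP `V ↦ [U_k(V)]` IS CONTINUOUS: for every `U(n)`, every `L ≥ 2`, `d = 4`, over the small data and at every
# level, given ONE minimiser `U♯` over `V₀` and ANY open neighbourhood `𝒪` of `U♯` (product topology), EVENTUALLY as the unitary `N`-periodic datum `V → V₀` every
# constrained minimiser over `V` has a periodic unitary GAUGE COPY inside `𝒪` — gen 113's Berge upper hemicontinuity (`NE7MinimalOrbitDatumContinuity`) read through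
# the uniqueness of the minimal orbit (✓ p810527): continuity of Bałaban's background field `U_k(V)` in the datum MODULO GAUGE, the qualitative clause of
# [Balaban1985Variational] p. 279 («U_k(V) … analytic functions of V») for OUR minimisers

Cell `pub-balaban`, rung (B)+1 sub-cell t4, lineage `b2b-balaban-t4-ne7-p1` (CRUX PROVER NE7 #1 = OWNER of BINDER row NE7), generation 113.  Memo
`t4/b2b-balaban-t4-ne7-p1-g113/ROAD-G113.md` §5.  Over gen 113's `NE7MinimalOrbitDatumContinuity.minimisers_upperHemicontinuous` and gen 109's ✓ p810527
`NE7MinimalOrbitUniqueGeneric.minimal_orbit_unique_generic`.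
THE ARGUMENT.  `𝒰 := {U : some periodic unitary gauge copy of U lies in 𝒪}` is open (a union of preimages of `𝒪` under the continuous maps `U ↦ U^{w}`) and contains every
minimiser over `V₀` (each is a gauge copy of `U♯ ∈ 𝒪` by orbit uniqueness); Berge's upper hemicontinuity puts every minimiser over nearby data in `𝒰`.
WHAT ([folklore]; 0 def, 0 sorry; `d = 4`, every `U(n)`, every `L ≥ 2`).  `continuous_gaugeAct` (the gauge action `U ↦ U^{w}` is continuous in the product topology);
**`minimal_orbit_continuous_modGauge`**: `∃ ε₀ > 0, ∀ 0 < ε ≤ ε₀, ∀ N ≥ 1, ∃ δ_V > 0, ∀ V₀ (unitary, N-periodic, SmallField V₀ δ_V), ∀ k, ∃ U♯, IsMinimiser 4 (sfClass 4 L N ε)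
L N k V₀ U♯ ∧ ∀ 𝒪 open ∋ U♯, ∀ᶠ V in 𝓝 V₀, V unitary ∧ N-periodic → ∀ U minimiser over V, ∃ w, IsUnitarySite w ∧ IsPeriodicSite w (N·L^k) ∧ gaugeAct w U ∈ 𝒪`.
HONEST FRAMING (page 1): soft topology over landed kernel theorems; qualitative continuity only (print: analyticity — NOT claimed); nothing of Bałaban's asserted as an
axiom and NOT his method; finite 4-torus, small data, thresholds existential (`δ_V(n, L, ε, N)`); NOT NE7 as a spine node (dagwriter∕referees' call), NOT NE3; spine
0∕9; NOT infinite volume, NOT mass gap, NOT BetaPertH, NOT Clay (continuum YM on T⁴ ⇐ BetaPertH ∧ nine spine estimates).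
-/

set_option autoImplicit false

open scoped BigOperators Matrix Matrix.Norms.L2Operator Topology
open NormedSpace Finset Set Filter

namespace Summit.QuantumFields.BalabanUV.T4Continuum.NE7MinimalOrbitDatumContinuityGauge

open Literature.MathematicalPhysics.QuantumFieldTheory.Balaban1983to89
open B7Prop1Explicit B7Prop2Explicit
open T4AveragingDeficitWall (IsUnitaryCfg SmallField)
open T4AveragingDeficitWallBoundary (IsPeriodicCfg)
open MinimalActionSandwich (IsMinimiser admissible)
open MinimalActionRate (sfClass)
open NE3EnergyShapes (IsUnitarySite IsPeriodicSite)
open NE7MinimalOrbitUniqueGeneric (minimal_orbit_unique_generic)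
open NE7MinimalOrbitDatumContinuity (minimisers_upperHemicontinuous)
open MinimalActionCompact (continuous_eval)

noncomputable section

variable {n : Type} [Fintype n] [DecidableEq n]

/-- The gauge action `U ↦ U^{w}` is continuous in the product topology (bondwise products with fixed units). [folklore] -/
theorem continuous_gaugeAct {d : ℕ} (w : Site d → (Matrix n n ℂ)ˣ) :
    Continuous fun U : Site d → Fin d → (Matrix n n ℂ)ˣ => gaugeAct w U := by
  refine continuous_pi fun x => continuous_pi fun μ => ?_
  show Continuous fun U : Site d → Fin d → (Matrix n n ℂ)ˣ => w x * U x μ * (w (x + e μ))⁻¹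
  exact (continuous_const.mul (continuous_eval (n := n) x μ)).mul continuous_const

/-- **THE MINIMAL ORBIT IS CONTINUOUS IN THE DATUM MODULO GAUGE, EVERY `U(n)`, EVERY `L ≥ 2`, `d = 4`** (statement and argument in the file header): over the small data,
at every level, for one minimiser `U♯` over `V₀` and every open `𝒪 ∋ U♯`, EVENTUALLY as the unitary `N`-periodic datum `V → V₀` every constrained minimiser over `V` has a
periodic unitary gauge copy in `𝒪`. [folklore] -/
theorem minimal_orbit_continuous_modGauge [Nonempty n] {L : ℕ} (hL : 2 ≤ L) :
    ∃ ε₀ : ℝ, 0 < ε₀ ∧ ∀ ε : ℝ, 0 < ε → ε ≤ ε₀ → ∀ (N : ℕ) [NeZero N], 1 ≤ N →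
      ∃ δV : ℝ, 0 < δV ∧
        ∀ V₀ ∈ {V : Site 4 → Fin 4 → (Matrix n n ℂ)ˣ | IsUnitaryCfg V ∧ IsPeriodicCfg V (N : ℤ) ∧ SmallField V δV},
        ∀ k : ℕ, ∃ Us : Site 4 → Fin 4 → (Matrix n n ℂ)ˣ, IsMinimiser 4 (sfClass 4 L N ε) L N k V₀ Us ∧
          ∀ 𝒪 : Set (Site 4 → Fin 4 → (Matrix n n ℂ)ˣ), IsOpen 𝒪 → Us ∈ 𝒪 →
            ∀ᶠ V in 𝓝 V₀, IsUnitaryCfg V → IsPeriodicCfg V (N : ℤ) →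
              ∀ U : Site 4 → Fin 4 → (Matrix n n ℂ)ˣ, IsMinimiser 4 (sfClass 4 L N ε) L N k V U →
                ∃ w : Site 4 → (Matrix n n ℂ)ˣ, IsUnitarySite w ∧ IsPeriodicSite w ((N * L ^ k : ℕ) : ℤ) ∧ gaugeAct w U ∈ 𝒪 := by
  obtain ⟨ε₁, hε₁, H1⟩ := minimisers_upperHemicontinuous (n := n) hL
  obtain ⟨ε₂, hε₂, H2⟩ := minimal_orbit_unique_generic (n := n) hL
  refine ⟨min ε₁ ε₂, lt_min hε₁ hε₂, fun ε hε hεle N _ hN => ?_⟩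
  obtain ⟨δ₁, hδ₁, K1⟩ := H1 ε hε (hεle.trans (min_le_left _ _)) N hN
  obtain ⟨δ₂, hδ₂, K2⟩ := H2 ε hε (hεle.trans (min_le_right _ _)) N hN
  refine ⟨min δ₁ δ₂, lt_min hδ₁ hδ₂, fun V₀ hV₀ k => ?_⟩
  obtain ⟨hV₀u, hV₀P, hV₀δ⟩ := hV₀
  have hV₀1 : V₀ ∈ {V : Site 4 → Fin 4 → (Matrix n n ℂ)ˣ | IsUnitaryCfg V ∧ IsPeriodicCfg V (N : ℤ) ∧ SmallField V δ₁} :=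
    ⟨hV₀u, hV₀P, MinimalActionRate.SmallField.mono hV₀δ (min_le_left _ _)⟩
  have hV₀2 : V₀ ∈ {V : Site 4 → Fin 4 → (Matrix n n ℂ)ˣ | IsUnitaryCfg V ∧ IsPeriodicCfg V (N : ℤ) ∧ SmallField V δ₂} :=
    ⟨hV₀u, hV₀P, MinimalActionRate.SmallField.mono hV₀δ (min_le_right _ _)⟩
  obtain ⟨Us, hUs, horbit⟩ := K2 V₀ hV₀2 k
  refine ⟨Us, hUs, fun 𝒪 h𝒪o hUs𝒪 => ?_⟩
  -- the open set of configurations with a gauge copy in `𝒪`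
  set 𝒰 : Set (Site 4 → Fin 4 → (Matrix n n ℂ)ˣ) :=
    {U | ∃ w : Site 4 → (Matrix n n ℂ)ˣ, IsUnitarySite w ∧ IsPeriodicSite w ((N * L ^ k : ℕ) : ℤ) ∧ gaugeAct w U ∈ 𝒪} with h𝒰
  have h𝒰o : IsOpen 𝒰 := by
    rw [isOpen_iff_mem_nhds]
    rintro U ⟨w, hw, hwP, hwU⟩
    exact mem_of_superset ((h𝒪o.preimage (continuous_gaugeAct w)).mem_nhds hwU) fun U' hU' => ⟨w, hw, hwP, hU'⟩
  have h𝒰min : ∀ U : Site 4 → Fin 4 → (Matrix n n ℂ)ˣ, IsMinimiser 4 (sfClass 4 L N ε) L N k V₀ U → U ∈ 𝒰 := by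
    intro U hU
    obtain ⟨u, hu, huP, hg⟩ := horbit U hU
    exact ⟨u, hu, huP, by rw [hg]; exact hUs𝒪⟩
  filter_upwards [K1 V₀ hV₀1 k 𝒰 h𝒰o h𝒰min] with V hV hVu hVP U hU
  exact hV hVu hVP U hU

end

end Summit.QuantumFields.BalabanUV.T4Continuum.NE7MinimalOrbitDatumContinuityGauge
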